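import Literature.AnabelianGeometry.AbsoluteAnabelian.AbsTopIII.FrobeniusPictureMLFShift
import Literature.AnabelianGeometry.AbsoluteAnabelian.AbsTopIII.FrobeniusPictureMLFCoresCompatible
import Literature.AnabelianGeometry.AbsoluteAnabelian.DiagramShiftInvarianceLifts

/-!
# [AbsTopIII] Corollary 3.6 (v), third sentence — the CORES part, unconditionally: the nexus
# self-equivalences `Φ_m` are compatible with the universal cores family `K₀`

S. Mochizuki, *Topics in Absolute Anabelian Geometry III*, Cor. 3.6 (v) p. 80 of the kurims manuscript
(`paper:url-5493eb38cbb7`; bib key `MochizukiAbsTopIII2015`): "the self-equivalences in these nexus-classes are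
compatible with the families of homotopies that constitute the cores and observable of (i), (iii)" (typed
`LogFrobeniusData.ShiftCompatStmt`, `FrobeniusPictureMLFCompatibility.lean`; Def. 3.5 (v)
`OneMorphism.CompatibleWith`).  Seat abc-iut-w6-d023 (row «Cor36-SHIFT» of the abc-iut-L4-t5 lineage's
blueprint `HOME/staging/L4/L4-t5/DISCHARGE-PLAN-Cor36-compat.md`, §(v)).

The diagram `𝒟` of Cor. 3.6 is INVARIANT under the translation `LFVertex.shift m` of its first row
(`comapAlong_shift`: every first-row vertex carries `𝒳`, every `log`-edge the functor `𝔩𝔬𝔤`), and so are the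
structure functors over `ℰ` (`overE`, proof of Cor. 3.6 (i): "the algorithms of Corollary 1.10 are
group-theoretic") and the set of core vertices (rows 4–6, fixed by the shift).  By the generic toolkit
(`DiagramShiftInvariance*.lean`) the universal family `K₀ = coresFamily` over `ℰ` through the core vertices
(`FrobeniusPictureMLFCoresCompatible.lean`, abc-iut-L4-t5) is therefore invariant under the shift — boundary set
(`coresFamily_E_shift_iff`) and homotopies (`coresFamily_η_shift_heq`) — and the nexus self-equivalence
`Φ_m = shiftEquiv m` (`FrobeniusPictureMLFShift.lean`: identity vertex functors, unitor 2-cells) is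
COMPATIBLE with `K₀` in the sense of Def. 3.5 (v) (`compatibleWith_shiftEquiv_coresFamily`), for EVERY
`Δ : LogFrobeniusData` and every `m : ℤ`, with no hypothesis.  The `𝔖_log` part of the master family (pairs
into `𝒩`) is treated in the sequel.  Pure category theory over the typed data; nothing here bears on
[IUTchIII] Cor. 3.12; no side is taken on inter-universal Teichmüller theory.
-/

namespace Literature.AnabelianGeometry.AbsoluteAnabelian

open _root_.CategoryTheory _root_.Quiver

universe u

namespace LogFrobeniusData

open DiagramOfCategories

variable (Δ : LogFrobeniusData.{u})

/-! ### The diagram and its structure functors over `ℰ` are invariant under the shift -/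

/-- **`𝒟` is invariant under the translation of its first row**: `(shift m)^*𝒟 = 𝒟` (every first-row vertex
carries `𝒳`, every edge `⋎+1 → ⋎` the functor `𝔩𝔬𝔤`, every `id_⋎` the same functor).
[cite: MochizukiAbsTopIII2015, Corollary 3.6 (v) p.80] -/
theorem comapAlong_shift (m : ℤ) : Δ.diagram.comapAlong (LFVertex.shift.{u} m) = Δ.diagram :=
  DiagramOfCategories.ext' (fun a => by cases a <;> rfl) (fun a => by cases a <;> exact HEq.rfl)
    (fun {a b} e => by
      cases a <;> cases b <;> first | exact (PEmpty.elim e) | exact HEq.rfl)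

/-- The translation of the first row is surjective on paths (it has the two-sided inverse `shift (-m)`).
[cite: MochizukiAbsTopIII2015, Corollary 3.6 (v) p.80] -/
theorem exists_shift_mapPath_eq (m : ℤ) {a b : LFVertex}
    (p' : Path ((LFVertex.shift.{u} m).obj a) ((LFVertex.shift.{u} m).obj b)) :
    ∃ p : Path a b, (LFVertex.shift.{u} m).mapPath p = p' :=
  Prefunctor.exists_mapPath_eq_of_inverse (LFVertex.shift_comp_neg m) (LFVertex.shift_neg_comp m) p'

/-- The core vertices (rows 4–6) are fixed by the shift. [cite: MochizukiAbsTopIII2015, Corollary 3.6 (v) p.80] -/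
theorem coreVertices_shift (m : ℤ) : ∀ w : LFVertex, coreVertices w → coreVertices (LFVertex.shiftObj m w) := by
  intro w hw
  rcases hw with rfl | rfl | rfl
  · exact Or.inl rfl
  · exact Or.inr (Or.inl rfl)
  · exact Or.inr (Or.inr rfl)

/-- **The structure functors over `ℰ` are invariant under the shift**: `(shift m)^*(N, μ) ≍ (N, μ)` for
`overE` (first-row vertices all carry `(𝒳 → ℰ) ∘ id_⋎`, `log`-edges all carry `log ≅ 𝟭` whiskered).
[cite: MochizukiAbsTopIII2015, Corollary 3.6 (i) p.80] -/
theorem overE_comapAlong_shift_heq (m : ℤ) : HEq (Δ.overE.comapAlong (LFVertex.shift.{u} m)) Δ.overE :=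
  OverData.heq_of_eq (Δ.comapAlong_shift m) (fun a => by cases a <;> exact HEq.rfl)
    (fun {a b} e => by
      cases a <;> cases b <;> first | exact (PEmpty.elim e) | exact HEq.rfl)

/-- The full-faithfulness witnesses at the core vertices do not see the shift (the shift fixes rows 4–6).
[cite: MochizukiAbsTopIII2015, Corollary 3.6 (i) p.80] -/
theorem coreVertices_fullyFaithful_shift_heq (m : ℤ) (w : LFVertex) (hw : coreVertices w) :
    HEq (Δ.coreVertices_fullyFaithful (LFVertex.shiftObj m w) (coreVertices_shift m w hw))
      (Δ.coreVertices_fullyFaithful w hw) := by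
  rcases hw with rfl | rfl | rfl <;> exact HEq.rfl

/-! ### The cores family `K₀` is invariant under the shift -/

/-- The boundary set `E_W` of `K₀` is stable under the shift. [cite: MochizukiAbsTopIII2015, Corollary 3.6 (v) p.80] -/
theorem coresFamily_E_shift (m : ℤ) {a b : LFVertex} {P Q : Path a b} (h : Δ.coresFamily.E P Q) :
    Δ.coresFamily.E ((LFVertex.shift.{u} m).mapPath P) ((LFVertex.shift.{u} m).mapPath Q) :=
  univE_mapPath coreVertices (LFVertex.shift.{u} m) (coreVertices_shift m) h

/-- **`Φ_Γ⃗` induces a bijection between the boundary sets** (Def. 3.5 (v)) for `K₀`: `E_{K₀}(γ₁,γ₂) ↔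
E_{K₀}(shift γ₁, shift γ₂)`. [cite: MochizukiAbsTopIII2015, Corollary 3.6 (v) p.80] -/
theorem coresFamily_E_shift_iff (m : ℤ) {a b : LFVertex} (P Q : Path a b) :
    Δ.coresFamily.E P Q ↔ Δ.coresFamily.E ((LFVertex.shift.{u} m).mapPath P) ((LFVertex.shift.{u} m).mapPath Q) :=
  HomotopyFamily.E_mapPath_iff_of_inverse (LFVertex.shift_comp_neg m) Δ.coresFamily.E
    (fun _ _ _ _ h => Δ.coresFamily_E_shift m h) (fun _ _ _ _ h => Δ.coresFamily_E_shift (-m) h) P Q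

/-- **The homotopies of `K₀` are invariant under the shift**: `ζ^{K₀}_{(shift γ₁, shift γ₂)} ≍ ζ^{K₀}_{(γ₁,γ₂)}`
(the canonical identifications over `ℰ` do not see the re-indexing of the first row).
[cite: MochizukiAbsTopIII2015, Corollary 3.6 (v) p.80] -/
theorem coresFamily_η_shift_heq (m : ℤ) {a b : LFVertex} {P Q : Path a b} (h : Δ.coresFamily.E P Q)
    (h' : Δ.coresFamily.E ((LFVertex.shift.{u} m).mapPath P) ((LFVertex.shift.{u} m).mapPath Q)) :
    HEq (Δ.coresFamily.η h') (Δ.coresFamily.η h) :=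
  univFamily_η_mapPath_heq Δ.overE coreVertices Δ.coreVertices_fullyFaithful (LFVertex.shift.{u} m)
    (Δ.comapAlong_shift m) (Δ.overE_comapAlong_shift_heq m) (coreVertices_shift m)
    (Δ.coreVertices_fullyFaithful_shift_heq m) h h'

/-! ### Cor. 3.6 (v), third sentence, for the cores family -/

/-- **[AbsTopIII] Cor. 3.6 (v), third sentence, CORES PART — PROVED for every `Δ`**: the nexus self-equivalence
`Φ_m` translating the first row by `m` is compatible, in the sense of Def. 3.5 (v) (`Φ_Γ⃗` induces a bijection of
the boundary sets; the homotopies commute with the `Φ_{[γ]}`), with the universal family `K₀` of homotopies over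
`ℰ` through the core vertices — the family that "constitutes the cores of (i)" (`exists_compatible_cores`).
[cite: MochizukiAbsTopIII2015, Corollary 3.6 (v) p.80] -/
theorem compatibleWith_shiftEquiv_coresFamily (m : ℤ) :
    Nonempty ((Δ.shiftEquiv m).hom.CompatibleWith Δ.coresFamily Δ.coresFamily) :=
  OneMorphism.nonempty_compatibleWith_of_invariant (Δ.shiftMor m) (Δ.comapAlong_shift m)
    (Δ.shiftApp_heq_id m) (Δ.shiftMor_iso_app m) (fun _ _ p' => exists_shift_mapPath_eq m p')
    Δ.coresFamily Δ.coresFamily (fun _ _ P Q => Δ.coresFamily_E_shift_iff m P Q)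
    (fun _ _ _ _ h => Δ.coresFamily_η_shift_heq m h _)

end LogFrobeniusData

end Literature.AnabelianGeometry.AbsoluteAnabelian
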